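import Summits.BirchSwinnertonDyer.BirchSwinnertonDyer.Theorems.Rank1ResidualJetSwapExclusion
import Summits.BirchSwinnertonDyer.BirchSwinnertonDyer.Theorems.ClassRecordThreeEulerHalvesAtThreeWalkTildeSign
import Summits.BirchSwinnertonDyer.BirchSwinnertonDyer.Theorems.ClassRecordThreeEulerHalvesAtThreeWalkCebotarev
import Summits.BirchSwinnertonDyer.BirchSwinnertonDyer.Theorems.ClassRecordThreeEulerHalvesAtThreeWalkSupplyRootTransverse
import Summits.BirchSwinnertonDyer.BirchSwinnertonDyer.Theorems.Rank1ResidualJetTransverseClass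
import Summits.BirchSwinnertonDyer.Rank1Residual.JET.KolyvaginClassSignUnconditional
import HarnessLib

/-!
# T1 JET (cell `bsd-jet`), road K — striking McCallum 1991 Prop. 5.2 (`h52`), brick 2a: Kolyvagin's
# PRIME SWAP `n ↦ n·ℓ'/ℓ₀` at minimal depth — the `λ'` half (root class, auxiliary class, Čebotarev)

HONEST FRAMING (programme file §HONESTY, verbatim): «no tranche here proves BSD; ARM L moves the
LITERAL column of an r ≤ 1 census into the kernel-proved-modulo-named-print column.» THEOREMS ONLY
(seat `bsd-jet-pv-2`, session g6; `--supports stmt-BirchSwinnertonDyer-14418`, helper); 0 classes move;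
road-K DOCUMENTARY. Nothing is asserted about any curve; no item closes.

WHAT. The bridge `JET.derivedPoint_divisible_of_prop52_of_section6_min` consumes the named print
`h52` (McCallum Prop. 5.2, `C = {0}`) only as «level raising at minimal depth»: from a conductor `n ∈ Λ`
carrying a derived point of the MINIMAL exact depth `u = m_∞` (`M(n) ≥ u + 1`), reach conductors of
arbitrarily large index `M` keeping the depth. McCallum's printed proof (LMS LN 153, pp. 305–306) is
Kolyvagin's swap: replace a prime `ℓ₀ ∣ n` of small index by a fresh `ℓ'` of large index. This file
proves the TWO HALVES of one swap in the kernel, at level `p`, on the classes of the `p^u`-th ROOTS of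
the derived points (stepL's tilde classes; the printed level-`p` auxiliary class works only for them):
* `exists_swapPrime` (the `λ'` half): the root class `x = c₁(P_n ∕ p^u)` (order `p`, sign `e₀`), a
  non-zero class `t` of sign `−e₀` in `H¹_{𝓕(n/ℓ₀)^{λ₀}}(K, E[p])` (Jetchev Lemma 5.2 (iii) count at the
  RELAXED place `λ₀`), the DECOUPLED Čebotarev prime `ℓ' > b` of index `≥ 1 + j` keeping `loc_{λ'} x`,
  `loc_{λ'} t` non-zero (stepL `Koly.exists_kolyvaginPrime_addOrderOf_localization_eq_shift`), and the
  transport `loc_{λ'} c_{1+u}(P_n) ≠ 0` one level up (`ι_* x = c_{1+u}(P_n)`).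
* `not_dvd_of_swap` (the `λ₀` half): for COMPATIBLE data `d ≼ d'` (`n ∣ n ℓ'`) and `d'' ≼ d'`
  (`n'' = nℓ'/ℓ₀ ∣ nℓ'`): McCallum Prop. 4.4 at `λ'` moves the non-vanishing to `c_{1+u}(P_{nℓ'})`, whose
  root class `y` (sign `−e₀`, in `H¹_{𝓕(nℓ')}`) is then NOT Kummer at `λ'`; the EXCLUSION LEMMA
  (`Swap.localization_eq_zero_of_strict_of_relaxed`, brick 1) with `t` forbids `loc_{λ₀} y = 0`; Prop. 4.4
  at `λ₀` moves `loc_{λ₀} c_{1+u}(P_{nℓ'}) ≠ 0` to `c_{1+u}(P_{n''}) ≠ 0`, i.e. `p^{u+1} ∤ P_{n''}`.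
Named print used: `h44` (McCallum Prop. 4.4, typed fact), the Poitou–Tate package `inv` and a Weil
datum (cite-only facts' family), [GZ86 III (3.1)] in the receptacle form `hGZ`, and the local
print-to-type inputs of the walk (`hloc`, `hdisj`, `h𝒯σ`, `h𝒯sd`) in stepL's shapes; the Gross 5.3
sign is the tree theorem `JET.grossProp53_schema_kolyvagin` (taken as `h53`). The COMPATIBLE DATA are
hypotheses here (the tree constructs the upward datum `d ≼ d'`, `JET.exists_compatible_data_of_grossCM`;
the simultaneous downward restriction `d'' ≼ d'` is the one plumbing input left, recorded in the
cell's STATUS as the binder `hcompat`). References (locators only; no cited FACT is declared):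
[cite: McCallumLMS1991, §5 Prop. 5.2 and proof (pp. 304–306), §4 Prop. 4.4, §3 Cor. 3.2]
[cite: Jetchev2008, §3.1 item 7, Lemma 5.1, Lemma 5.2 (iii), Thm. 5.1] [cite: GrossLMS1991, Prop. 5.3,
Prop. 9.6] [cite: Howard2004HeegnerKolyvagin, Lemma 2.7.3, Thm. 2.1.11]. Design: no definitions;
`K : Type`. Axioms: `propext`, `Classical.choice`, `Quot.sound`.
-/

set_option autoImplicit false

noncomputable section

open scoped Classical Pointwise
open Function NumberField IsDedekindDomain WeierstrassCurve Field
open Literature.NumberTheory.EllipticCurves Literature.NumberTheory.GaloisRepresentations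
open Literature.NumberTheory.EllipticCurves.Jetchev2008 Literature.NumberTheory.EllipticCurves.KolyvaginCocycle
open Literature.NumberTheory.EllipticCurves.ModularForms
open Literature.NumberTheory.GaloisCohomology Literature.NumberTheory.Automorphic
open Literature.NumberTheory.GaloisRepresentations.DiscreteGaloisModule (transverseSubgroup SelmerStructure)
open Summit.BirchSwinnertonDyer.Rank1Residual.JET.SelmerVocabulary
open Summit.BirchSwinnertonDyer.Rank1Residual.JET.GlobalDuality
open Summit.BirchSwinnertonDyer.Rank1Residual.X11b
open Summit.BirchSwinnertonDyer.Rank1Residual.X11b.Three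
open Summit.BirchSwinnertonDyer.BirchSwinnertonDyer.Theorems

namespace Summit.BirchSwinnertonDyer.Rank1Residual.JET.Swap

variable {K : Type} [Field K] [NumberField K] (W : WeierstrassCurve ℚ) [W.IsElliptic]
  [W.IsGloballyMinimal] [NeZero (W.conductorNorm ℤ)]

/-- A finite place of `K` containing the rational prime `ℓ`, when `(ℓ)` is a prime ideal of `𝓞 K`
(`ℓ` inert). Elementary. [cite: GrossLMS1991, §3 (3.1)] -/
theorem exists_place_natCast_mem {ℓ : ℕ} (hℓ : ℓ.Prime)
    (hinert : (Ideal.span {(ℓ : 𝓞 K)}).IsPrime) :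
    ∃ v : HeightOneSpectrum (𝓞 K), (ℓ : 𝓞 K) ∈ v.asIdeal := by
  refine ⟨⟨Ideal.span {(ℓ : 𝓞 K)}, hinert, ?_⟩, Ideal.mem_span_singleton_self _⟩
  rw [Ne, Ideal.span_singleton_eq_bot]
  exact_mod_cast hℓ.ne_zero

/-- From `#f(H) ≠ 1` there is `t ∈ H` with `f t ≠ 0`. Elementary. [folklore] -/
theorem exists_mem_map_ne_zero {A B : Type*} [AddCommGroup A] [AddCommGroup B] (f : A →+ B)
    (H : AddSubgroup A) (h : Nat.card (H.map f) ≠ 1) : ∃ t ∈ H, f t ≠ 0 := by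
  by_contra hc
  push Not at hc
  apply h
  rw [AddSubgroup.card_eq_one, eq_bot_iff]
  rintro _ ⟨t, ht, rfl⟩
  exact (AddSubgroup.mem_bot).mpr (hc t ht)

section Prime

variable (τ : K ≃ₐ[ℚ] K) (p : ℕ) [Fact p.Prime] [NeZero (p ^ 1)]
  [Finite (geomTorsion (W.baseChange K) ((p ^ 1 : ℕ) : ℤ))]
  (e : geomTorsion (W.baseChange K) ((p ^ 1 : ℕ) : ℤ) → geomTorsion (W.baseChange K) ((p ^ 1 : ℕ) : ℤ) →
    AlgebraicClosure K)
  (hμ : ∀ S T, e S T ^ (p ^ 1) = 1)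
  (hadd₁ : ∀ S₁ S₂ T, e (S₁ + S₂) T = e S₁ T * e S₂ T)
  (hadd₂ : ∀ S T₁ T₂, e S (T₁ + T₂) = e S T₁ * e S T₂)
  (hgal : ∀ (g : absoluteGaloisGroup K) (S T : geomTorsion (W.baseChange K) ((p ^ 1 : ℕ) : ℤ)),
    g • e S T = e (g • S) (g • T))
  (halt : ∀ T, e T T = 1) (hnondeg : ∀ T, (∀ S, e S T = 1) → T = 0)
  (hτe : ∀ S T, liftAut τ (e S T) =
    e ((isLiftOfAut_liftAut τ).torsionMap W ((p ^ 1 : ℕ) : ℤ) S)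
      ((isLiftOfAut_liftAut τ).torsionMap W ((p ^ 1 : ℕ) : ℤ) T))

include halt hnondeg hτe in
/-- **The `λ'` half of Kolyvagin's swap** (McCallum, proof of Prop. 5.2, pp. 305–306, with Lemma 5.3
and Cor. 3.2; run at level `p` on the root class). Data: the frame (`K` imaginary quadratic,
`(N_E, d_K) = 1`, `d_K < −4`, `p` odd, `ρ̄_{E,p}` onto, `τ ≠ 1`, `τ² = 1`), the level-`p` Poitou–Tate
package and Weil datum, a transverse family `𝒯` at level `p` (`τ`-stable, self-dual at the places over
Kolyvagin primes) with the local index `hloc`, the Gross 5.3 sign `ε` (`h53`, Kolyvagin-guarded), a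
square-free conductor `n` of Kolyvagin primes of index `≥ 1 + u` with data at its divisors whose derived
point `P_n` has EXACT depth `u`, a prime `ℓ₀ ∣ n`, and bounds `j ≥ u`, `b`. CONCLUSION: a Kolyvagin
prime `ℓ' > b` of index `≥ 1 + j`, `ℓ' ∤ n`, with places `λ' ∋ ℓ'`, `λ₀ ∋ ℓ₀`, a class
`t ∈ (H¹_{𝓕(n/ℓ₀)^{λ₀}})^{−e₀}` (`e₀ = ε·(−1)^{#primes of n}`) with `loc_{λ'} t ≠ 0`, and
`loc_{λ'} c_{1+u}(P_n) ≠ 0`. [cite: McCallumLMS1991, §5 proof of Prop. 5.2 (pp. 305–306), Lemma 5.3]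
[cite: Jetchev2008, Lemma 5.1, Lemma 5.2 (iii)] -/
theorem exists_swapPrime (hK : IsImaginaryQuadratic K)
    (hD3 : NumberField.discr K ≠ -3) (hD4 : NumberField.discr K ≠ -4)
    (hH : SatisfiesHeegnerHypothesis (W.conductorNorm ℤ) K) (hp2 : p ≠ 2) (hρ : W.HasSurjectiveModNGaloisRep p) (hτ1 : τ ≠ 1) (hττ : τ * τ = 1)
    (Dt : ModularParametrizationData W (W.conductorNorm ℤ)) (β : ℤ) (ι : K →+* ℂ)
    (inv : LocalInvariants K (p ^ 1)) (hperf : inv.IsPerfect) (hvan : inv.SumLocalTermEqZero)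
    (hSC : inv.SelmerComplement) (hinv : inv.IsConjCompatible τ)
    (𝒯 : SelmerStructure ((W.baseChange K).torsionGaloisModule ((p ^ 1 : ℕ) : ℤ)))
    (h𝒯σ : ∀ (c : ℕ), Squarefree c →
      (∀ q ∈ c.primeFactors, Zhang2014.IsKolyvaginPrime (W.conductorNorm ℤ) W K p q) →
      ∀ (v w : HeightOneSpectrum (𝓞 K)) (h : τ • v = w), v ∈ placesDividing K c →
      ∀ x : galoisCohomology (((W.baseChange K).torsionGaloisModule ((p ^ 1 : ℕ) : ℤ)).toLocal
        (Sum.inr v : Place K)) 1,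
      x ∈ 𝒯 (Sum.inr v) → conjActPlace W τ ((p ^ 1 : ℕ) : ℤ) h x ∈ 𝒯 (Sum.inr w))
    (h𝒯sd : ∀ (c : ℕ), Squarefree c →
      (∀ q ∈ c.primeFactors, Zhang2014.IsKolyvaginPrime (W.conductorNorm ℤ) W K p q) →
      ∀ v ∈ placesDividing K c,
      inv.dualTransported 𝒯 (weilDualIntertwining (W.baseChange K) (p ^ 1) e hμ hadd₁ hadd₂ hgal)
        (Sum.inr v) = 𝒯 (Sum.inr v))
    (hloc : ∀ ℓ : ℕ, Zhang2014.IsKolyvaginPrime (W.conductorNorm ℤ) W K p ℓ →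
      1 ≤ Zhang2014.kolyvaginIndex W p ℓ →
      ∀ (v : HeightOneSpectrum (𝓞 K)), (ℓ : 𝓞 K) ∈ v.asIdeal → ∀ (hfix : τ • v = v) (s : ℤ),
      (s = 1 ∨ s = -1) →
      ((W.baseChange K).kummerSelmerStructure ((p ^ 1 : ℕ) : ℤ) (Sum.inr v)).relIndex
        ((conjActPlace W τ ((p ^ 1 : ℕ) : ℤ) hfix - s • AddMonoidHom.id _).ker) = p ^ 1)
    {u j : ℕ} (hju : u ≤ j) (b : ℕ) {n l₀ : ℕ} (hn : Squarefree n)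
    (hnK : ∀ q ∈ n.primeFactors, Zhang2014.IsKolyvaginPrime (W.conductorNorm ℤ) W K p q ∧
      1 + u ≤ Zhang2014.kolyvaginIndex W p q)
    (hl₀ : l₀ ∈ n.primeFactors)
    (data : (m : ℕ) → m ∣ n → KolyvaginHeegnerData Dt β ι m)
    (hdvd : ∃ Q : (W.baseChange (ringClassField K ι n)).toAffine.Point,
      ((p ^ u : ℕ) : ℤ) • Q = (data n dvd_rfl).derivedPoint)
    (hndvd : ¬ ∃ Q : (W.baseChange (ringClassField K ι n)).toAffine.Point,
      ((p ^ (u + 1) : ℕ) : ℤ) • Q = (data n dvd_rfl).derivedPoint) :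
    ∃ (ℓ' : ℕ) (v' v₀ : HeightOneSpectrum (𝓞 K))
      (t : galoisCohomology ((W.baseChange K).torsionGaloisModule ((p ^ 1 : ℕ) : ℤ)) 1),
      b < ℓ' ∧ Zhang2014.IsKolyvaginPrime (W.conductorNorm ℤ) W K p ℓ' ∧
      1 + j ≤ Zhang2014.kolyvaginIndex W p ℓ' ∧ ℓ' ∉ n.primeFactors ∧
      (ℓ' : 𝓞 K) ∈ v'.asIdeal ∧ (l₀ : 𝓞 K) ∈ v₀.asIdeal ∧
      t ∈ signPart W K τ ((p ^ 1 : ℕ) : ℤ) (-(-W.rootNumber * (-1) ^ n.primeFactors.card))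
        (((selmerF W ((p ^ 1 : ℕ) : ℤ) 𝒯 (placesDividing K (n / l₀))).relaxedAt {v₀}).selmerGroup) ∧
      galoisCohomology.localization ((W.baseChange K).torsionGaloisModule ((p ^ 1 : ℕ) : ℤ))
        (Sum.inr v' : Place K) 1 t ≠ 0 ∧
      galoisCohomology.localization ((W.baseChange K).torsionGaloisModule ((p ^ (1 + u) : ℕ) : ℤ))
        (Sum.inr v' : Place K) 1 ((data n dvd_rfl).kolyvaginClass (Fact.out : p.Prime) (1 + u)) ≠ 0 := by
  have hp : p.Prime := Fact.out
  have hND : IsCoprime ((W.conductorNorm ℤ : ℕ) : ℤ) (NumberField.discr K) :=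
    KolyvaginAssembly.isCoprime_discr_of_satisfiesHeegnerHypothesis hK hH
  have hD : NumberField.discr K < -4 := KolyvaginAssembly.discr_lt_neg_four hK ⟨hD3, hD4⟩
  have hn0 : n ≠ 0 := hn.ne_zero
  have hl₀p : l₀.Prime := Nat.prime_of_mem_primeFactors hl₀
  have hl₀n : l₀ ∣ n := Nat.dvd_of_mem_primeFactors hl₀
  have hKol₀ : Zhang2014.IsKolyvaginPrime (W.conductorNorm ℤ) W K p l₀ := (hnK l₀ hl₀).1
  -- §1 the root class `x = c₁(P_n / p^u)`: order `p`, sign `e₀`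
  obtain ⟨hA1, Q, hQ, hQP, hord, -⟩ := Koly.exists_tildeClass_of_exactDepth_of_surj (Dt := Dt) (β := β)
    (ι := ι) hK hND hD hp hp2 hρ (k := 1) (u := u) le_rfl hn hnK data hdvd hndvd
  set x : galH1Torsion (W.baseChange K) ((p ^ 1 : ℕ) : ℤ) :=
    kolyvaginClass (W.baseChange K) ((p ^ 1 : ℕ) : ℤ)
      ((W.baseChange K).zsmul_geomPoints_surjective_of_charZero
        (by exact_mod_cast pow_ne_zero 1 hp.ne_zero)) hA1 ((data n dvd_rfl).toGeomPoints Q) hQ with hxdef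
  have hx0 : x ≠ 0 := by
    intro h
    have : addOrderOf x = 1 := by rw [h, addOrderOf_zero]
    rw [hord, pow_one] at this
    exact hp.one_lt.ne' this
  -- the sign of `x`: transported DOWN from the unconditional sign of `c_{1+u}(P_n)` along `ι_*`
  have hP : (data n dvd_rfl).toGeomPoints (data n dvd_rfl).derivedPoint ∈
      invPoints (absoluteGaloisGroup K) (data n dvd_rfl).pointsSubgroup ((p ^ (1 + u) : ℕ) : ℤ) :=
    KolyCert.toGeomPoints_derivedPoint_mem_invPoints_of_dvd_zhang hK ι Dt hp hND hD hn hnK data n dvd_rfl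
  have hroot := Walk.torsionH1OfDvd_rootClass W hK hp hp2 hρ hn0 (data n dvd_rfl) 1 u Q hA1 hQ hQP hP
  have hdn : p ^ 1 ∣ p ^ (1 + u) := pow_dvd_pow p (Nat.le_add_right 1 u)
  obtain ⟨he₀, hκsign⟩ := sign_conjAct_kolyvaginClass hK hD3 hD4 hH hp2 hρ τ hτ1 Dt β ι hn
    (k := 1 + u) (by omega) hnK (data n dvd_rfl)
  set e₀ : ℤ := -W.rootNumber * (-1) ^ n.primeFactors.card with he₀def
  have hxsign : conjAct W τ ((p ^ 1 : ℕ) : ℤ) x = e₀ • x :=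
    conjAct_eq_smul_of_torsionH1OfDvd W τ _ (torsionH1OfDvd_pow_injective W hK hp hp2 hρ 1 u) e₀ x
      (by rw [hroot]; exact hκsign)
  -- §2 the places `λ₀ ∋ ℓ₀`; the conductor `m = n / ℓ₀`
  obtain ⟨v₀, hv₀⟩ := exists_place_natCast_mem (K := K) hl₀p hKol₀.2.2.2.2.1
  have hfix₀ : τ • v₀ = v₀ := smul_place_eq_self_of_natCast_mem τ hl₀p.ne_zero hKol₀.2.2.2.2.1 v₀ hv₀
  set m : ℕ := n / l₀ with hmdef
  have hmn : m ∣ n := Nat.div_dvd_of_dvd hl₀n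
  have hm : Squarefree m := hn.squarefree_of_dvd hmn
  have hm0 : m ≠ 0 := hm.ne_zero
  have hmK : ∀ q ∈ m.primeFactors, Zhang2014.IsKolyvaginPrime (W.conductorNorm ℤ) W K p q :=
    fun q hq ↦ (hnK q (Nat.primeFactors_mono hmn hn0 hq)).1
  have hl₀m : l₀ ∉ m.primeFactors := by
    intro h
    have hdvd' : l₀ * l₀ ∣ n := by
      have := Nat.mul_dvd_mul_left l₀ (Nat.dvd_of_mem_primeFactors h)
      rwa [Nat.mul_div_cancel' hl₀n] at this
    exact hl₀p.one_lt.ne' (Nat.isUnit_iff.mp (hn l₀ hdvd'))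
  -- §3 the auxiliary class `t` (Jetchev Lemma 5.2 (iii) at the relaxed place `λ₀ ∤ m`)
  have hs : (-e₀ = 1 ∨ -e₀ = -1) := by rcases he₀ with h | h <;> [right; left] <;> omega
  have hcount := Walk.natCard_map_localization_signPart_relaxedAt W τ p 1 e hμ hadd₁ hadd₂ hgal halt
    hnondeg hτe hττ hp2 le_rfl inv hperf hvan hSC hinv 𝒯 hm0 (h𝒯σ m hm hmK) (h𝒯sd m hm hmK) hs
    (fun ℓ hℓ hk _ v hv hfix ↦ hloc ℓ hℓ hk v hv hfix _ hs) l₀ hKol₀ hKol₀.2.2.2.2.2 hl₀m v₀ hv₀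
  obtain ⟨t, ht, ht₀⟩ := exists_mem_map_ne_zero _ _ (by rw [hcount, pow_one]; exact hp.one_lt.ne')
  have ht0 : t ≠ 0 := fun h ↦ ht₀ (by rw [h, map_zero])
  have htsign : conjAct W τ ((p ^ 1 : ℕ) : ℤ) t = (-e₀) • t := ((mem_signPart_iff W K τ _ _ _ t).mp ht).2
  -- §4 the decoupled Čebotarev prime `ℓ'`
  obtain ⟨ℓ', hbℓ', hKol', hjℓ', hordloc⟩ :=
    Koly.exists_kolyvaginPrime_addOrderOf_localization_eq_shift W hK hp2 hρ τ hτ1 (k := 1) le_rfl j he₀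
      x t hxsign htsign ht0 (max b n)
  have hℓ'p : ℓ'.Prime := hKol'.1
  have hbℓ : b < ℓ' := lt_of_le_of_lt (le_max_left b n) hbℓ'
  have hℓ'n : ℓ' ∉ n.primeFactors := fun h ↦ by
    have := Nat.le_of_dvd (Nat.pos_of_ne_zero hn0) (Nat.dvd_of_mem_primeFactors h)
    exact absurd (lt_of_le_of_lt (le_max_right b n) hbℓ') (not_lt.mpr this)
  obtain ⟨v', hv'⟩ := exists_place_natCast_mem (K := K) hℓ'p hKol'.2.2.2.2.1
  obtain ⟨hxloc, htloc⟩ := hordloc v' hv'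
  have htv' : galoisCohomology.localization ((W.baseChange K).torsionGaloisModule ((p ^ 1 : ℕ) : ℤ))
      (Sum.inr v' : Place K) 1 t ≠ 0 := by
    intro h
    rw [h, addOrderOf_zero] at htloc
    exact ht0 (AddMonoid.addOrderOf_eq_one_iff.mp htloc.symm)
  have hxv' : galoisCohomology.localization ((W.baseChange K).torsionGaloisModule ((p ^ 1 : ℕ) : ℤ))
      (Sum.inr v' : Place K) 1 x ≠ 0 := by
    intro h
    rw [h, addOrderOf_zero] at hxloc
    exact hx0 (AddMonoid.addOrderOf_eq_one_iff.mp hxloc.symm)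
  -- §5 transport one level up at `λ'`: `ι_* x = c_{1+u}(P_n)`, `Γ_{K_λ'}` fixes `E[p^{1+u}]`
  have h1u : 1 + u ≤ Zhang2014.kolyvaginIndex W p ℓ' := le_trans (by omega) hjℓ'
  have htriv : ∀ (g : absoluteGaloisGroup (v'.adicCompletion K))
      (P : geomTorsion (W.baseChange K) ((p ^ (1 + u) : ℕ) : ℤ)), resGal (K := K) (v'.adicCompletion K) g • P = P :=
    Walk.resGal_adicCompletion_smul_torsion_eq_self W hK hKol' h1u v' hv'
  have hxup : galoisCohomology.localization ((W.baseChange K).torsionGaloisModule ((p ^ (1 + u) : ℕ) : ℤ))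
      (Sum.inr v' : Place K) 1 ((data n dvd_rfl).kolyvaginClass hp (1 + u)) ≠ 0 := by
    rw [← hroot]
    exact fun h ↦ hxv' ((localization_eq_zero_iff_torsionH1OfDvd W hdn (pow_ne_zero 1 hp.ne_zero)
      (pow_ne_zero _ hp.ne_zero) v' htriv x).mpr h)
  exact ⟨ℓ', v', v₀, t, hbℓ, hKol', hjℓ', hℓ'n, hv', hv₀, ht, htv', hxup⟩


end Prime

end Summit.BirchSwinnertonDyer.Rank1Residual.JET.Swap

end
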